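import Literature.NumberTheory.Automorphic.DualGroup
import Literature.NumberTheory.Automorphic.GLReindex
import HarnessLib

/-!
# The Buzzard–Gee element `(2ρ)(-1)` is Galois-fixed: discharge of `galAct_cGroupElt`
(trunk T-AUTOMORPHIC, G25 AutomorphicL; proof file of a named fact of `DualGroup.lean`)

`DualGroup.lean` vendors, for a dual group structure `D : L.DualGroupStr P b` on an L-group datum
`L` over `ℂ` (maximal torus `T̂ = D.torus ≤ Ĝ = L.dual`, identifications `eX : X*(T̂) ≃ Y`,
`eY : X_*(T̂) ≃ X` with the dual based root datum `(P.flip, b.flip)`, and the action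
`galRoot : Γ_F → Aut(P, b)` through which `L.galAct` acts on `T̂`), the named fact

* `LGroupData.DualGroupStr.galAct_cGroupElt D : ∀ σ, L.galAct σ D.cGroupElt = D.cGroupElt`,

where `D.cGroupElt = (2ρ)(-1)`, `2ρ = ∑_{α > 0} α ∈ X = X_*(T̂)` (Buzzard–Gee, *The conjectural
connections between automorphic representations and Galois representations*, §5.3,
Proposition 5.3.3: `e = χ(-1)` for `χ` the sum of the positive roots of `G` viewed as a
cocharacter of `T̂`; the dual isogeny `Ĝ × 𝔾ₘ → (G̃)^` with kernel `⟨(e, -1)⟩` "commutes with the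
Galois action used to define the L-groups", so `e` is `Γ_F`-fixed; equivalently, as in the proof
of Prop. 5.3.1 there, the sum of the positive roots is a Galois-stable element because the
Galois action `μ_G` on the based root datum permutes the positive roots).

This file proves it (**`galAct_cGroupElt_holds`**) from the fields of `DualGroupStr` alone, by the
printed argument made explicit on cocharacters:

1. `smul_twoRho_of_isBased`: a *based* automorphism `e ∈ Aut(P, b)` permutes the `b`-positive
   roots (it permutes the simple roots, hence preserves heights, `height_indexHom_of_isBased`),
   so `e • 2ρ = 2ρ`.
2. The Galois twist `σ ∘ λ` of the cocharacter `λ = 2ρ : 𝔾ₘ → T̂` is an algebraic cocharacter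
   of `T̂` (`exists_galTwist_cochar`, `isAlgebraicCochar_galTwist`: `Γ_F` preserves `T̂` and acts
   algebraically, fields `galAct_torus`, `isAlgebraic_galAct`), and
   `χ_y ∘ (σ ∘ λ) = χ_{σ⁻¹ • y} ∘ λ` on the nose (`charOfWeight_comp_galTwist`, field
   `galAct_char`), so `⟨χ_y, σ ∘ λ⟩ = ⟨χ_{σ⁻¹ • y}, λ⟩ = ⟨2ρ, σ⁻¹ • y⟩ = ⟨σ • 2ρ, y⟩ = ⟨2ρ, y⟩
   = ⟨χ_y, λ⟩` (field `pairing_eq`, invariance of the pairing `toLinearMap_smul_autCoweightAct`,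
   and step 1).
3. Two algebraic cocharacters of `T̂` with the same pairings against `X*(T̂)` are equal
   (`cochar_ext_of_charPairingInt`: `eX`, `eY` are isomorphisms and the pairing of `P` is
   perfect), so `σ ∘ λ = λ`; evaluating at `-1` gives `σ ε = ε`.

No structure theory of tori is used (in particular not the separation of points of `T̂` by
characters): the hypothesis structure `DualGroupStr` already identifies `X_*(T̂)` with `X` in
perfect pairing with `X*(T̂) ≃ Y`.

## References

* K. Buzzard, T. Gee, *The conjectural connections between automorphic representations and
  Galois representations*, in *Automorphic forms and Galois representations* 1, LMS Lecture Note
  Ser. 414 (2014), §5.3, Definition 5.3.2, Proposition 5.3.3 and its proof; proof of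
  Proposition 5.3.1 (a) [BuzzardGee2014] (arXiv:1009.0785).
* A. Borel, *Automorphic L-functions*, Proc. Symp. Pure Math. 33.2 (Corvallis 1979), §§1.2, 2.1
  (the action `μ_G` of `Γ_F` on the based root datum).
* M. Demazure, A. Grothendieck, *SGA 3*, Exp. XXI 6.1 (automorphisms of based root data).
-/

noncomputable section

open Field
open scoped MatrixGroups

namespace Literature.NumberTheory.Automorphic

/-! ### Based automorphisms fix `2ρ` -/

section BasedTwoRho

variable {ι R M N : Type*} [CommRing R] [CharZero R] [AddCommGroup M] [Module R M]
  [AddCommGroup N] [Module R N] {P : RootPairing ι R M N}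

/-- A based automorphism `e ∈ Aut(P, b)` preserves the height of every root: writing
`α_i = ∑_{j ∈ Δ} f_j α_j`, one has `α_{e i} = e • α_i = ∑_{j ∈ Δ} f_j α_{e j}` with `e` permuting
the simple roots `Δ = b.support`, so `ht(α_{e i}) = ∑_j f_j = ht(α_i)` (SGA 3 XXI 6.1; Bourbaki,
*Lie* VI §1.7). [folklore] -/
theorem height_indexHom_of_isBased (b : P.Base) {e : P.Aut} (he : e.IsBased b) (i : ι) :
    b.height (RootPairing.Equiv.indexHom P e i) = b.height i := by
  obtain ⟨f, -, -, hf⟩ := b.exists_root_eq_sum_int i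
  set π : ι ≃ ι := RootPairing.Equiv.indexHom P e with hπ_def
  have hπ : ∀ j, π j ∈ b.support ↔ j ∈ b.support := he
  have key : P.root (π i) = ∑ j ∈ b.support, f (π.symm j) • P.root j := by
    have h1 : P.root (π i) = e • P.root i := RootPairing.Equiv.root_indexEquiv_eq_smul P i e
    rw [h1, hf, Finset.smul_sum]
    refine Finset.sum_equiv π (fun j => (hπ j).symm) (fun j _ => ?_)
    rw [Equiv.symm_apply_apply, smul_comm, ← RootPairing.Equiv.root_indexEquiv_eq_smul]
    rfl
  rw [RootPairing.Base.height_eq_sum key, RootPairing.Base.height_eq_sum hf]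
  refine Finset.sum_equiv π.symm (fun j => ?_) (fun j _ => rfl)
  rw [← hπ (π.symm j), Equiv.apply_symm_apply]

/-- A based automorphism permutes the positive roots: `α_{e i} > 0 ↔ α_i > 0`
(SGA 3 XXI 6.1; Bourbaki, *Lie* VI §1.7). [folklore] -/
theorem isPos_indexHom_iff_of_isBased (b : P.Base) {e : P.Aut} (he : e.IsBased b) (i : ι) :
    b.IsPos (RootPairing.Equiv.indexHom P e i) ↔ b.IsPos i := by
  rw [RootPairing.Base.isPos_iff, RootPairing.Base.isPos_iff, height_indexHom_of_isBased b he]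

/-- **A based automorphism fixes `2ρ`**: `e • ∑_{α > 0} α = ∑_{α > 0} α` for `e ∈ Aut(P, b)`,
since `e` permutes the `b`-positive roots (Buzzard–Gee 2014, §5.3, proof of Prop. 5.3.1 (a):
the sum of the positive roots is Galois-stable; Bourbaki, *Lie* VI §1.10).
[cite: BuzzardGee2014, §5.3 proof of Prop. 5.3.1 (a)] -/
theorem smul_twoRho_of_isBased [Fintype ι] (b : P.Base) {e : P.Aut} (he : e.IsBased b) :
    e • b.twoRho = b.twoRho := by
  classical
  unfold RootPairing.Base.twoRho
  rw [Finset.smul_sum]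
  refine Finset.sum_equiv (RootPairing.Equiv.indexHom P e) (fun i => ?_) (fun i _ => ?_)
  · simp only [Finset.mem_filter, Finset.mem_univ, true_and]
    exact (isPos_indexHom_iff_of_isBased b he i).symm
  · exact (RootPairing.Equiv.root_indexEquiv_eq_smul P i e).symm

end BasedTwoRho

/-! ### Galois twists of cocharacters of `T̂` -/

namespace LGroupData.DualGroupStr

variable {F : Type*} [Field F]
variable {ι X Y : Type*} [AddCommGroup X] [AddCommGroup Y]
variable {L : LGroupData F} {P : RootPairing ι ℤ X Y} {b : P.Base}
variable (D : L.DualGroupStr P b)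

/-- The Galois twist `σ ∘ γ` of a cocharacter `γ : 𝔾ₘ → T̂` is again a cocharacter of `T̂`,
because `Γ_F` preserves `T̂` (`galAct_torus`; Borel, Corvallis 1979, §2.1). [folklore] -/
theorem exists_galTwist_cochar (σ : absoluteGaloisGroup F) (γ : ℂˣ →* ↥D.torus) :
    ∃ γ' : ℂˣ →* ↥D.torus, ∀ x : ℂˣ,
      Subgroup.inclusion D.torus_le (γ' x) =
        L.galAct σ (Subgroup.inclusion D.torus_le (γ x)) := by
  refine ⟨((L.dual.subtype.comp (L.galAct σ).toMonoidHom).comp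
      ((Subgroup.inclusion D.torus_le).comp γ)).codRestrict D.torus fun x => ?_, fun x => ?_⟩
  · exact D.galAct_torus σ (Subgroup.inclusion D.torus_le (γ x)) (γ x).2
  · exact Subtype.ext rfl

/-- The Galois twist of an *algebraic* cocharacter of `T̂` is algebraic: `Γ_F` acts on `Ĝ` by
algebraic automorphisms (`isAlgebraic_galAct`), and substituting Laurent polynomials into a
polynomial gives a Laurent polynomial (Springer 2.1.1, 3.2.1). [folklore] -/
theorem isAlgebraicCochar_galTwist (σ : absoluteGaloisGroup F) {γ γ' : ℂˣ →* ↥D.torus}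
    (hγ : IsAlgebraicCochar γ)
    (hγ' : ∀ x : ℂˣ, Subgroup.inclusion D.torus_le (γ' x) =
      L.galAct σ (Subgroup.inclusion D.torus_le (γ x))) :
    IsAlgebraicCochar γ' := by
  obtain ⟨Pσ, hPσ⟩ := D.isAlgebraic_galAct σ
  obtain ⟨Q, hQ⟩ := hγ
  refine ⟨fun c => MvPolynomial.bind₁ Q (Pσ c), fun x c => ?_⟩
  have h1 : ((γ' x : ↥D.torus) : GL (Fin L.rank) ℂ) =
      ((L.galAct σ (Subgroup.inclusion D.torus_le (γ x)) : ↥L.dual) : GL (Fin L.rank) ℂ) := by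
    have := congrArg Subtype.val (hγ' x)
    simpa only [Subgroup.coe_inclusion] using this
  have h2 : glCoordFun ((γ x : ↥D.torus) : GL (Fin L.rank) ℂ) =
      fun i => MvPolynomial.eval ![(x : ℂ), (x⁻¹ : ℂˣ)] (Q i) := funext (hQ x)
  rw [eval_bind₁, h1, ← h2]
  exact hPσ (Subgroup.inclusion D.torus_le (γ x)) c

/-- On characters the Galois twist is the coweight action: for `γ' = σ ∘ γ` and `y ∈ Y = X*(T̂)`,
`χ_y ∘ γ' = χ_{e⁻¹ • y} ∘ γ` where `e = galRoot σ` acts on `Y` by the covariant coweight action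
`autCoweightAct` (field `galAct_char`: `χ_{e • y'} (σ t) = χ_{y'} (t)`; Borel, Corvallis 1979,
§2.1). [folklore] -/
theorem charOfWeight_comp_galTwist (σ : absoluteGaloisGroup F) {γ γ' : ℂˣ →* ↥D.torus}
    (hγ' : ∀ x : ℂˣ, Subgroup.inclusion D.torus_le (γ' x) =
      L.galAct σ (Subgroup.inclusion D.torus_le (γ x)))
    {e : P.Aut} (he : ((D.galRoot σ : ↥(basedAutGroup P b)) : P.Aut) = e) (y : Y) :
    (charOfWeight D.eX y).comp γ' = (charOfWeight D.eX ((autCoweightAct e).symm y)).comp γ := by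
  subst he
  refine MonoidHom.ext fun x => ?_
  have key := D.galAct_char σ
    ((autCoweightAct ((D.galRoot σ : ↥(basedAutGroup P b)) : P.Aut)).symm y)
    (Subgroup.inclusion D.torus_le (γ x)) (γ x).2
  rw [LinearEquiv.apply_symm_apply] at key
  have h1 : (⟨((L.galAct σ (Subgroup.inclusion D.torus_le (γ x)) : ↥L.dual) : GL (Fin L.rank) ℂ),
      D.galAct_torus σ (Subgroup.inclusion D.torus_le (γ x)) (γ x).2⟩ : ↥D.torus) = γ' x := by
    apply Subtype.ext
    have := congrArg Subtype.val (hγ' x)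
    simpa only [Subgroup.coe_inclusion] using this.symm
  have h2 : (⟨((Subgroup.inclusion D.torus_le (γ x) : ↥L.dual) : GL (Fin L.rank) ℂ), (γ x).2⟩ :
      ↥D.torus) = γ x := Subtype.ext rfl
  rw [h1, h2] at key
  rw [MonoidHom.comp_apply, MonoidHom.comp_apply]
  exact key

/-- Two algebraic cocharacters of `T̂` with the same pairings against every algebraic character
are equal: `eY : X_*(T̂) ≃ X`, `eX : X*(T̂) ≃ Y`, and under these the character–cocharacter
pairing is the perfect pairing of `P` (field `pairing_eq` of `IsRootDatumOf`; Springer 3.2.11).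
[folklore] -/
theorem cochar_ext_of_charPairingInt (γ₁ γ₂ : ↥(cocharacterLattice D.torus))
    (h : ∀ χ : ↥(characterLattice D.torus),
      charPairingInt (χ : ↥D.torus →* ℂˣ) (γ₁ : ℂˣ →* ↥D.torus) =
        charPairingInt (χ : ↥D.torus →* ℂˣ) (γ₂ : ℂˣ →* ↥D.torus)) :
    γ₁ = γ₂ := by
  have hR := D.isBased.isRootDatumOf
  have key : P.toLinearMap (D.eY (Additive.ofMul γ₁)) =
      P.toLinearMap (D.eY (Additive.ofMul γ₂)) := by
    refine LinearMap.ext fun y => ?_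
    obtain ⟨χ, rfl⟩ : ∃ χ : ↥(characterLattice D.torus), D.eX (Additive.ofMul χ) = y :=
      ⟨Additive.toMul (D.eX.symm y), by simp⟩
    have h1 := hR.pairing_eq χ γ₁
    have h2 := hR.pairing_eq χ γ₂
    rw [RootPairing.flip_toLinearMap, LinearMap.flip_apply] at h1 h2
    rw [h1, h2, h χ]
  have hinj : Function.Injective P.toLinearMap :=
    (LinearMap.IsPerfPair.bijective_left P.toLinearMap).injective
  exact Additive.ofMul.injective (D.eY.injective (hinj key))

/-! ### The discharge -/

/-- **The Buzzard–Gee element is Galois-fixed** (discharge of the named fact `galAct_cGroupElt`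
of `DualGroup.lean`): `σ ε = ε` for `ε = (2ρ)(-1) ∈ T̂ ≤ Ĝ` and every `σ ∈ Γ_F` (Buzzard–Gee
2014, §5.3, Prop. 5.3.3 and its proof: the dual isogeny with kernel `⟨(e, -1)⟩` commutes with
the Galois action; proof of Prop. 5.3.1 (a): the sum of the positive roots is Galois-stable).
Proof: the Galois twist `σ ∘ λ` of the cocharacter `λ = 2ρ` of `T̂` is an algebraic cocharacter
with the same pairings as `λ` against every `χ_y ∈ X*(T̂)` — `⟨χ_y, σ ∘ λ⟩ = ⟨χ_{e⁻¹ • y}, λ⟩ =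
⟨2ρ, e⁻¹ • y⟩ = ⟨e • 2ρ, y⟩ = ⟨2ρ, y⟩` for `e = galRoot σ ∈ Aut(P, b)`
(`charOfWeight_comp_galTwist`, `pairing_eq`, `toLinearMap_smul_autCoweightAct`,
`smul_twoRho_of_isBased`) — hence `σ ∘ λ = λ` (`cochar_ext_of_charPairingInt`), and
`σ ε = (σ ∘ λ)(-1) = λ(-1) = ε`. [cite: BuzzardGee2014, §5.3 Prop. 5.3.3] -/
theorem galAct_cGroupElt_holds [Fintype ι] : D.galAct_cGroupElt := by
  intro σ
  obtain ⟨Λ, hΛ, hΛY⟩ : ∃ Λ : ↥(cocharacterLattice D.torus),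
      (Λ : ℂˣ →* ↥D.torus) = D.twoRhoCochar ∧ D.eY (Additive.ofMul Λ) = b.twoRho :=
    ⟨Additive.toMul (D.eY.symm b.twoRho), rfl, by simp⟩
  obtain ⟨γ', hγ'⟩ := D.exists_galTwist_cochar σ (Λ : ℂˣ →* ↥D.torus)
  have hγ'alg : IsAlgebraicCochar γ' := D.isAlgebraicCochar_galTwist σ Λ.2 hγ'
  obtain ⟨e, he⟩ : ∃ e : P.Aut, ((D.galRoot σ : ↥(basedAutGroup P b)) : P.Aut) = e := ⟨_, rfl⟩
  have heb : e.IsBased b := he ▸ (D.galRoot σ).2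
  have hR := D.isBased.isRootDatumOf
  have hpair : ∀ χ : ↥(characterLattice D.torus),
      charPairingInt (χ : ↥D.torus →* ℂˣ) γ' =
        charPairingInt (χ : ↥D.torus →* ℂˣ) (Λ : ℂˣ →* ↥D.torus) := by
    intro χ
    obtain ⟨y, hy⟩ : ∃ y : Y, D.eX (Additive.ofMul χ) = y := ⟨_, rfl⟩
    have hχ : (χ : ↥D.torus →* ℂˣ) = charOfWeight D.eX y := by
      subst hy
      simp [charOfWeight]
    obtain ⟨χ', hχ', hχ'X⟩ : ∃ χ' : ↥(characterLattice D.torus),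
        (χ' : ↥D.torus →* ℂˣ) = charOfWeight D.eX ((autCoweightAct e).symm y) ∧
          D.eX (Additive.ofMul χ') = (autCoweightAct e).symm y :=
      ⟨Additive.toMul (D.eX.symm ((autCoweightAct e).symm y)), rfl, by simp⟩
    calc charPairingInt (χ : ↥D.torus →* ℂˣ) γ'
        = charPairingInt (χ' : ↥D.torus →* ℂˣ) (Λ : ℂˣ →* ↥D.torus) := by
          rw [hχ, hχ']
          exact charPairingInt_congr (D.charOfWeight_comp_galTwist σ hγ' he y)
      _ = P.toLinearMap b.twoRho ((autCoweightAct e).symm y) := by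
          rw [← hR.pairing_eq χ' Λ, RootPairing.flip_toLinearMap, LinearMap.flip_apply, hχ'X, hΛY]
      _ = P.toLinearMap (e • b.twoRho) (autCoweightAct e ((autCoweightAct e).symm y)) :=
          (toLinearMap_smul_autCoweightAct e _ _).symm
      _ = P.toLinearMap b.twoRho y := by
          rw [LinearEquiv.apply_symm_apply, smul_twoRho_of_isBased b heb]
      _ = charPairingInt (χ : ↥D.torus →* ℂˣ) (Λ : ℂˣ →* ↥D.torus) := by
          rw [← hR.pairing_eq χ Λ, RootPairing.flip_toLinearMap, LinearMap.flip_apply, hy, hΛY]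
  have hΓΛ : (⟨γ', hγ'alg⟩ : ↥(cocharacterLattice D.torus)) = Λ :=
    D.cochar_ext_of_charPairingInt _ _ hpair
  have hγΛ : γ' = (Λ : ℂˣ →* ↥D.torus) := congrArg Subtype.val hΓΛ
  have h1 := hγ' (-1)
  rw [hγΛ, hΛ] at h1
  show L.galAct σ (Subgroup.inclusion D.torus_le (D.twoRhoCochar (-1))) =
    Subgroup.inclusion D.torus_le (D.twoRhoCochar (-1))
  exact h1.symm

end LGroupData.DualGroupStr

end Literature.NumberTheory.Automorphic
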